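import Summits.ABC.ABC.Theorems.TwistAmplificationMazurKaneLawRecordDefs

/-!
# Crux `TwistAmplification.MazurKaneLaw` (stmt-ABC-2757), line `fibre-toolkit-lp-wall-map`: the record-instance fact with a
# SLACK COEFFICIENT (record pipeline v2, fine records)

`RecordInstance J s₀ Vc` (`…RecordDefs.lean`) asks the LP certificate for `log_Λ B ≤ Vc + σ` uniformly in the slack
`σ = recordSlack … ≤ 1/1000`. Because the dictionary also relaxes the radical budget to `L ≤ s₀ + σ` and every tool by `+σ`, the
LP value at slack `σ` exceeds its value at `σ = 0` by about `2σ`, so a record exponent `Vc` is certifiable in that form only with a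
margin of `≈ 1.5/1000` above the exact LP value — which loses the abc-hit exponent `7/12` (LP value `0.58261` at `s = 1`,
`J = 7`) and the last `1/1000` of the sub-Kane range below `16/9`. The variant below keeps everything (binders, slack, cap
`1/1000`) and only multiplies the slack in the CONCLUSION by a constant `K ≥ 1`: `log_Λ B ≤ Vc + K·σ`. Since the endgame evaluates
the instance only where `σ ≤ min(1/1000, η/K)`, `RecordInstanceK K J s₀ Vc` gives the same record `RecordAt s₀ Vc`
(`shapeCount_le_of_recordInstanceK`, file `…RecordFineEndgame.lean`), while the LP lemma `… → D ≤ Vc + K·σ` is certifiable for every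
`Vc` strictly above the `σ = 0` value (take `K` ≥ the slack sensitivity, `K = 3` in practice). Nothing is proved here.
-/

noncomputable section

-- `Summit.<Summit>.<Problem>` is the mandated summit-side namespace; the duplicate `ABC.ABC` is deliberate (single-conjunct summit).
set_option linter.dupNamespace false

open Finset
open Literature.NumberTheory.DiophantineGeometry
open Literature.NumberTheory.DiophantineGeometry.AbcShapes

namespace Summit.ABC.ABC.Theorems.MazurKaneLaw.Toolkit

/-- THE RECORD-INSTANCE FACT WITH SLACK COEFFICIENT `K` for `(J, s₀, Vc)`: verbatim the hypotheses of `RecordInstance J s₀ Vc`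
(shape data in dimension `J + e` with the standing hypotheses of the exponent dictionary, dyadic level `C₀ ≥ 1`, radical exponent `t`,
`B > 0`, the determinant tool beyond `P₀ ≥ 1`, the two square-root lattice tools, slack `σ = recordSlack J (J+e) (2C₀) Dτ P₀ t s₀ ≤ 1/1000`),
with the conclusion `log_{2C₀} B ≤ Vc + K · σ`. `RecordInstance = RecordInstanceK 1` up to `one_mul`. -/
def RecordInstanceK (K : ℝ) (J : ℕ) (s₀ Vc : ℝ) : Prop :=
  ∀ {e : ℕ} {c₁ c₂ c₃ C₀ : ℕ}, 0 < c₁ → 0 < c₂ → 0 < c₃ → 1 ≤ C₀ →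
  ∀ {X Y Z : Fin (J + e) → ℕ}, (∀ i, 0 < X i) → (∀ i, 0 < Y i) → (∀ i, 0 < Z i) →
  ∀ {T Dτ : ℕ}, c₁ * shapeVal (fun i => 2 * X i) ≤ T → c₂ * shapeVal (fun i => 2 * Y i) ≤ T →
    c₃ * shapeVal (fun i => 2 * Z i) ≤ T → (∀ m : ℕ, m ≠ 0 → m ≤ T → m.divisors.card ≤ Dτ) →
  C₀ ≤ shapeVal (fun _ : Fin (J + e) => 2) * (c₃ * shapeVal Z) →
  c₁ * shapeVal X ≤ 2 * C₀ → c₂ * shapeVal Y ≤ 2 * C₀ → c₃ * shapeVal Z ≤ 2 * C₀ →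
  ∀ {t : ℝ}, (∏ i, ((X i : ℝ) * Y i * Z i)) ≤ (2 * C₀ : ℝ) ^ t →
  0 < shapeCount c₁ c₂ c₃ X Y Z →
  ∀ {P₀ : ℝ}, 1 ≤ P₀ →
  (∀ i : Fin (J + e), 1 ≤ (i : ℕ) → ∀ P : ℝ, P₀ ≤ P →
    48 * ((X i : ℝ) * Y i * Z i) ≤
      ((c₁ * offVal ({i} : Finset (Fin (J + e))) X : ℕ) : ℝ) * ((c₂ * offVal ({i} : Finset (Fin (J + e))) Y : ℕ) : ℝ) *
        ((c₃ * offVal ({i} : Finset (Fin (J + e))) Z : ℕ) : ℝ) * P ^ 3 →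
    (shapeCount c₁ c₂ c₃ X Y Z : ℝ) ≤
      ((subBox ({i} : Finset (Fin (J + e))) X).card * (subBox ({i} : Finset (Fin (J + e))) Y).card *
          (subBox ({i} : Finset (Fin (J + e))) Z).card : ℕ) *
        (Dτ : ℝ) ^ (3 * ((i : ℕ) + 2)) * (24 * ((((i : ℕ) : ℝ) + 1) * (((i : ℕ) : ℝ) + 2))) * P) →
  SqrtLatticeToolX → SqrtLatticeToolZ →
  recordSlack J (J + e) (2 * C₀) Dτ P₀ t s₀ ≤ 1 / 1000 →
    Real.logb (2 * C₀) (shapeCount c₁ c₂ c₃ X Y Z) ≤ Vc + K * recordSlack J (J + e) (2 * C₀) Dτ P₀ t s₀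

/-- Sanity/registration lemma (registered sub-goal `recordInstanceK_one_iff` of crux stmt-ABC-2757, stated verbatim): at `K = 1` the
variant is the original record-instance fact. -/
theorem recordInstanceK_one_iff : ∀ (J : ℕ) (s₀ Vc : ℝ), Summit.ABC.ABC.Theorems.MazurKaneLaw.Toolkit.RecordInstanceK 1 J s₀ Vc ↔ Summit.ABC.ABC.Theorems.MazurKaneLaw.Toolkit.RecordInstance J s₀ Vc := by
  intro J s₀ Vc
  simp only [RecordInstanceK, RecordInstance, one_mul]

/-- The original record-instance fact gives the variant at every `K ≥ 1` wherever the slack is nonnegative (as it is where the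
endgame evaluates it): `log B ≤ Vc + σ ≤ Vc + K σ` for `0 ≤ σ`, `1 ≤ K`. -/
theorem recordInstanceK_of_recordInstance {K : ℝ} (hK : 1 ≤ K) {J : ℕ} {s₀ Vc : ℝ}
    (h : RecordInstance J s₀ Vc) :
    ∀ {e : ℕ} {c₁ c₂ c₃ C₀ : ℕ}, 0 < c₁ → 0 < c₂ → 0 < c₃ → 1 ≤ C₀ →
    ∀ {X Y Z : Fin (J + e) → ℕ}, (∀ i, 0 < X i) → (∀ i, 0 < Y i) → (∀ i, 0 < Z i) →
    ∀ {T Dτ : ℕ}, c₁ * shapeVal (fun i => 2 * X i) ≤ T → c₂ * shapeVal (fun i => 2 * Y i) ≤ T →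
      c₃ * shapeVal (fun i => 2 * Z i) ≤ T → (∀ m : ℕ, m ≠ 0 → m ≤ T → m.divisors.card ≤ Dτ) →
    C₀ ≤ shapeVal (fun _ : Fin (J + e) => 2) * (c₃ * shapeVal Z) →
    c₁ * shapeVal X ≤ 2 * C₀ → c₂ * shapeVal Y ≤ 2 * C₀ → c₃ * shapeVal Z ≤ 2 * C₀ →
    ∀ {t : ℝ}, (∏ i, ((X i : ℝ) * Y i * Z i)) ≤ (2 * C₀ : ℝ) ^ t →
    0 < shapeCount c₁ c₂ c₃ X Y Z →
    ∀ {P₀ : ℝ}, 1 ≤ P₀ →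
    (∀ i : Fin (J + e), 1 ≤ (i : ℕ) → ∀ P : ℝ, P₀ ≤ P →
      48 * ((X i : ℝ) * Y i * Z i) ≤
        ((c₁ * offVal ({i} : Finset (Fin (J + e))) X : ℕ) : ℝ) * ((c₂ * offVal ({i} : Finset (Fin (J + e))) Y : ℕ) : ℝ) *
          ((c₃ * offVal ({i} : Finset (Fin (J + e))) Z : ℕ) : ℝ) * P ^ 3 →
      (shapeCount c₁ c₂ c₃ X Y Z : ℝ) ≤
        ((subBox ({i} : Finset (Fin (J + e))) X).card * (subBox ({i} : Finset (Fin (J + e))) Y).card *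
            (subBox ({i} : Finset (Fin (J + e))) Z).card : ℕ) *
          (Dτ : ℝ) ^ (3 * ((i : ℕ) + 2)) * (24 * ((((i : ℕ) : ℝ) + 1) * (((i : ℕ) : ℝ) + 2))) * P) →
    SqrtLatticeToolX → SqrtLatticeToolZ →
    0 ≤ recordSlack J (J + e) (2 * C₀) Dτ P₀ t s₀ → recordSlack J (J + e) (2 * C₀) Dτ P₀ t s₀ ≤ 1 / 1000 →
      Real.logb (2 * C₀) (shapeCount c₁ c₂ c₃ X Y Z) ≤ Vc + K * recordSlack J (J + e) (2 * C₀) Dτ P₀ t s₀ := by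
  intro e c₁ c₂ c₃ C₀ hc₁ hc₂ hc₃ hC₀ X Y Z hX hY hZ T Dτ hTX hTY hTZ hD hC₀le hvX hvY hvZ t hP hB P₀ hP₀ hdet hQX hQZ hσ0 hσm
  have h1 := h hc₁ hc₂ hc₃ hC₀ hX hY hZ hTX hTY hTZ hD hC₀le hvX hvY hvZ hP hB hP₀ hdet hQX hQZ hσm
  nlinarith [h1, hσ0, hK]

end Summit.ABC.ABC.Theorems.MazurKaneLaw.Toolkit

end
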